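import Summits.AtomisticToContinuum.FouriersLaw.Theorems.BondHeatUncertaintySubdiffusiveBondHeatJunctionRatioTemperedPairing

/-!
# `JunctionRatioResponseLink` — file 24b of the junction-ratio programme: the piece **[LINK]**
# (moments of the response density: `τ_i = ∫ p_i² h dμ_T`, `∫ h dμ_T = 0`)

Route `BondHeatUncertainty`, residual `BoundedResponse` (stmt-AtomisticToContinuum-11071), leaf [BI]
`EscapeGrading.FirstBondBracket` (file 19b), g64 weak-form skeleton `[BI] ⟸ [EXT] ∧ [LINK]` (critic rows
879/884/888).  The response data of 19a test only `C_c^∞` observables (`IsResponseDensityAt`), while the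
bracket identity pairs the response density `h` with `p_1²` and with `1`.  **[LINK]** closes that gap with
NO analytic input beyond the tree: the first-order expansion of the steady states holds on the WEIGHTED `C²`
CLASS `|φ| ≤ C e^{ϑH}` (this is the `key` step inside the tree proof of item 9144 `ResponseDensity`:
`pinnedChain_linear_response_of_uniformMixing` + `pinnedChain_exists_responseDensity_of_dual` + the
discharged inputs `Corrector.pinnedChain_uniformMixing`, `pinnedChain_hDUAL`), re-assembled here as
`exists_weightedResponseDensity` (§B).  Any `IsResponseDensityAt`-density `h` agrees with the weighted
density `h̃` against `C_c^∞` (limits along `δ ↓ 0` are unique, §C), hence against every smooth TEMPERED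
observable (energy cutoffs `χ_R = χ(H/R) → 1` + dominated convergence, §A/§C), which gives (§D):

* `IsMomentCoefficientAt.eq_integral_sq_mul` : `IsResponseDensityAt … h → IsMomentCoefficientAt … i τ →
  τ = ∫ p_i² h dμ_T` (every site `i`; uses `∫ p_i² dμ_T = T`, 23a);
* `IsResponseDensityAt.integral_eq_zero` : `∫ h dμ_T = 0` (steady states are probability measures).

Remark (dead end recorded): the `δ`-uniform exponential moments of the steady states do NOT suffice for
[LINK] — the tail of `(μ_δ - μ_T)/δ` is not controlled by uniform moments; the weighted linear response is
the right (and available) input.  No definitions; all theorems fully proved; standard axioms.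
-/

noncomputable section

open MeasureTheory Filter Topology Set
open scoped NNReal ENNReal ContDiff

namespace Summit.AtomisticToContinuum.FouriersLaw.Theorems.SubdiffusiveBondHeat.EscapeGrading

open Literature.MathematicalPhysics.KineticTheory.HeatConduction
open Literature.Probability.Process Literature.MathematicalPhysics.KineticTheory OscillatorChain
open Summit.AtomisticToContinuum.FouriersLaw.Theorems.SubdiffusiveBondHeat.JunctionDefectGrading

variable {N : ℕ} {ω₂ lam β γ : ℝ}

/-! ## A. Calculus: expansions as one-sided limits; tempered ⇒ sub-exponential; energy cutoffs -/

/-- An `o(δ)`-expansion `|A δ - A₀ - δ L| ≤ δ ε` (`0 < δ < δ₀(ε)`) is the one-sided derivative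
`(A δ - A₀)/δ → L` as `δ ↓ 0`. [folklore] -/
theorem tendsto_slope_of_expansion {A : ℝ → ℝ} {A₀ L : ℝ}
    (h : ∀ ε : ℝ, 0 < ε → ∃ δ₀ : ℝ, 0 < δ₀ ∧ ∀ δ : ℝ, 0 < δ → δ < δ₀ → |A δ - A₀ - δ * L| ≤ δ * ε) :
    Tendsto (fun δ : ℝ => (A δ - A₀) / δ) (𝓝[>] 0) (𝓝 L) := by
  rw [Metric.tendsto_nhdsWithin_nhds]
  intro ε hε
  obtain ⟨δ₀, hδ₀, hA⟩ := h (ε / 2) (half_pos hε)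
  refine ⟨δ₀, hδ₀, fun {δ} hδ hdist => ?_⟩
  rw [Set.mem_Ioi] at hδ
  rw [Real.dist_eq, sub_zero, abs_of_pos hδ] at hdist
  have hb := hA δ hδ hdist
  have hδne : δ ≠ 0 := hδ.ne'
  have e : (A δ - A₀) / δ - L = (A δ - A₀ - δ * L) / δ := by
    field_simp
  rw [Real.dist_eq, e, abs_div, abs_of_pos hδ, div_lt_iff₀ hδ]
  have hεδ : 0 < ε * δ := mul_pos hε hδ
  linarith

/-- A tempered function is dominated by every exponential weight `e^{ϑH}`, `ϑ > 0`
(`(1 + H)^m ≤ (m! e^ϑ/ϑ^m) e^{ϑH}`, `LightConeBondHeat.one_add_pow_le_exp`). -/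
theorem IsTempered.abs_le_exp {F : PhaseSpace N → ℝ} (hF : IsTempered ω₂ lam β γ N F)
    (hω : 0 ≤ ω₂) (hl : 0 ≤ lam) (hβ : 0 ≤ β) {ϑ : ℝ} (hϑ : 0 < ϑ) :
    ∃ C : ℝ, ∀ y, |F y| ≤ C * Real.exp (ϑ * (pinnedChain ω₂ lam β γ).hamiltonian N y) := by
  obtain ⟨C, m, hC⟩ := hF
  refine ⟨|C| * (m.factorial * Real.exp ϑ / ϑ ^ m), fun y => ?_⟩
  have hH := pinnedChain_hamiltonian_nonneg hω hl hβ γ N y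
  have h1 := LightConeBondHeat.one_add_pow_le_exp m hH hϑ
  calc |F y| ≤ C * (1 + (pinnedChain ω₂ lam β γ).hamiltonian N y) ^ m := hC y
    _ ≤ |C| * (1 + (pinnedChain ω₂ lam β γ).hamiltonian N y) ^ m :=
        mul_le_mul_of_nonneg_right (le_abs_self C) (pow_nonneg (by linarith) m)
    _ ≤ |C| * ((m.factorial * Real.exp ϑ / ϑ ^ m) *
          Real.exp (ϑ * (pinnedChain ω₂ lam β γ).hamiltonian N y)) :=
        mul_le_mul_of_nonneg_left h1 (abs_nonneg C)
    _ = _ := by ring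

/-- A continuous tempered function is in `L²(μ_T)` (`T > 0`). -/
theorem IsTempered.memLp_two {F : PhaseSpace N → ℝ} (hF : IsTempered ω₂ lam β γ N F)
    (hFc : Continuous F) (hω : 0 < ω₂) (hl : 0 ≤ lam) (hβ : 0 ≤ β) {T : ℝ} (hT : 0 < T) :
    MemLp F 2 ((pinnedChain ω₂ lam β γ).gibbsMeasure N T) :=
  (memLp_two_iff_integrable_sq hFc.aestronglyMeasurable).2
    ((pinnedChain ω₂ lam β γ).integrable_gibbsMeasure
      ((hF.pow 2).integrable_mul_gibbsDensity (hFc.pow 2) hω hl hβ hT))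

/-- The energy cutoffs exhaust: `χ(H(x)/R) = 1` for all large `R` (indeed for `R ≥ max (H x) 1`). -/
theorem eventually_cutoff_eq_one (x : PhaseSpace N) :
    ∀ᶠ R : ℝ in atTop, smoothCutoff ((pinnedChain ω₂ lam β γ).hamiltonian N x / R) = 1 := by
  filter_upwards [eventually_ge_atTop (max ((pinnedChain ω₂ lam β γ).hamiltonian N x) 1)] with R hR
  have hR1 : 0 < R := lt_of_lt_of_le one_pos ((le_max_right _ _).trans hR)
  exact smoothCutoff_of_le_one ((div_le_one hR1).2 ((le_max_left _ _).trans hR))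

/-- `|χ(H/R)| ≤ 1`. -/
theorem abs_cutoff_hamiltonian_le_one (R : ℝ) (x : PhaseSpace N) :
    |smoothCutoff ((pinnedChain ω₂ lam β γ).hamiltonian N x / R)| ≤ 1 := by
  rw [abs_of_nonneg (smoothCutoff_nonneg _)]
  exact smoothCutoff_le_one _

/-- **Cutoff removal.** If `φ·g ∈ L¹(μ_T)` then `∫ χ(H/R) φ g dμ_T → ∫ φ g dμ_T` as `R → ∞`
(dominated convergence, `|χ| ≤ 1`, `χ(H/R) → 1` pointwise). -/
theorem tendsto_integral_cutoff_mul {T : ℝ} {φ g : PhaseSpace N → ℝ}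
    (hg : Integrable (fun x => φ x * g x) ((pinnedChain ω₂ lam β γ).gibbsMeasure N T)) :
    Tendsto (fun R : ℝ => ∫ x, smoothCutoff ((pinnedChain ω₂ lam β γ).hamiltonian N x / R) *
        (φ x * g x) ∂(pinnedChain ω₂ lam β γ).gibbsMeasure N T)
      atTop (𝓝 (∫ x, φ x * g x ∂(pinnedChain ω₂ lam β γ).gibbsMeasure N T)) := by
  refine tendsto_integral_filter_of_dominated_convergence (fun x => ‖φ x * g x‖)
    (Eventually.of_forall fun R => ?_) (Eventually.of_forall fun R => ae_of_all _ fun x => ?_) hg.norm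
    (ae_of_all _ fun x => ?_)
  · exact ((contDiff_smoothCutoff (n := 0)).continuous.comp
      ((pinnedChain_contDiff_hamiltonian ω₂ lam β γ N (n := 0)).continuous.div_const R)).aestronglyMeasurable.mul
      hg.aestronglyMeasurable
  · rw [norm_mul]
    exact mul_le_of_le_one_left (norm_nonneg _)
      (by rw [Real.norm_eq_abs]; exact abs_cutoff_hamiltonian_le_one R x)
  · refine tendsto_const_nhds.congr' ?_
    filter_upwards [eventually_cutoff_eq_one (ω₂ := ω₂) (lam := lam) (β := β) (γ := γ) x] with R hR
    rw [hR, one_mul]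

/-! ## B. (WR) The weighted linear response of the steady states, re-assembled from the tree -/

/-- **(WR) Linear response on the weighted `C²` class.** For the pinned chain (all parameters `> 0`),
`T > 0`, `N ≥ 1`: there are `ϑ > 0` and `h̃ ∈ L²(μ_T)` such that for every `φ ∈ C²` with `|φ| ≤ C e^{ϑH}`
and every family `μ` of weak steady states (`μ T_L T_R` steady at `(T_L, T_R)`):
`δ⁻¹ (∫ φ dμ_{T+δ/2,T-δ/2} - ∫ φ dμ_T) → ∫ φ h̃ dμ_T` as `δ → 0`, `δ ≠ 0`.  This is the `key` step of the
tree proof of item 9144 (`responseDensity_conclusion_of_hyps`) with its two inputs discharged in the tree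
(`Corrector.pinnedChain_uniformMixing`, `pinnedChain_hDUAL`) and NESS uniqueness
(`bondHeatUncertainty_nessUnique_holds`, `steadyFamily_isInvariant`). [re-assembly of tree theorems] -/
theorem exists_weightedResponseDensity (hω : 0 < ω₂) (hl : 0 < lam) (hβ : 0 < β) (hγ : 0 < γ)
    {T : ℝ} (hT : 0 < T) (hN : 0 < N) :
    ∃ ϑ : ℝ, 0 < ϑ ∧ ∃ hw : PhaseSpace N → ℝ, MemLp hw 2 ((pinnedChain ω₂ lam β γ).gibbsMeasure N T) ∧
      ∀ (φ : PhaseSpace N → ℝ) (C : ℝ), ContDiff ℝ 2 φ →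
        (∀ y, |φ y| ≤ C * Real.exp (ϑ * (pinnedChain ω₂ lam β γ).hamiltonian N y)) →
        ∀ μ : ℝ → ℝ → Measure (PhaseSpace N),
          (∀ T_L T_R : ℝ, 0 < T_L → 0 < T_R →
            (pinnedChain ω₂ lam β γ).IsSteadyState N T_L T_R (μ T_L T_R)) →
          Tendsto (fun δ : ℝ => ((∫ x, φ x ∂(μ (T + δ / 2) (T - δ / 2))) -
              ∫ x, φ x ∂((pinnedChain ω₂ lam β γ).gibbsMeasure N T)) / δ)
            (𝓝[≠] 0) (𝓝 (∫ x, φ x * hw x ∂((pinnedChain ω₂ lam β γ).gibbsMeasure N T))) := by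
  have huniq := bondHeatUncertainty_nessUnique_holds ω₂ lam β γ hω hl hβ hγ
  obtain ⟨δ₀, ϑ, Cm, c, hδ₀, hδ₀T, hϑ, hϑT, h2ϑ, hCm, hc, hUM⟩ :=
    OddSectorIrreversibility.Corrector.pinnedChain_uniformMixing hω hl.le hβ hγ hN hT
  obtain ⟨hw, hL2, -, hrepr⟩ := pinnedChain_exists_responseDensity_of_dual hω hl.le hβ hγ hN hT hϑ h2ϑ
    (pinnedChain_hDUAL hω hl.le hβ.le hγ hN hT hϑ h2ϑ)
  refine ⟨ϑ, hϑ, hw, hL2, fun φ C hφ2 hφ μ hμ => ?_⟩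
  have hident := fun (T_L T_R : ℝ) (hL : 0 < T_L) (hR : 0 < T_R) =>
    steadyFamily_isInvariant hω hl.le hβ hγ hN (huniq N) μ hμ hL hR
  have hTT : μ T T = (pinnedChain ω₂ lam β γ).gibbsMeasure N T :=
    huniq N T T hT hT _ _ (hμ T T hT hT) (pinnedChain_isSteadyState_gibbsMeasure hω hl.le hβ.le γ N hT)
  have hμP : ∀ δ : ℝ, |δ| < δ₀ → IsProbabilityMeasure (μ (T + δ / 2) (T - δ / 2)) := fun δ hδ =>
    (hident _ _ (bath_facts_of_abs_lt hδ₀T hϑT hδ).1 (bath_facts_of_abs_lt hδ₀T hϑT hδ).2.1).1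
  have hμI : ∀ δ : ℝ, |δ| < δ₀ → ∀ t : ℝ≥0, (μ (T + δ / 2) (T - δ / 2)).bind
      ((pinnedChain ω₂ lam β γ).transitionKernel N (T + δ / 2) (T - δ / 2) t) =
      μ (T + δ / 2) (T - δ / 2) := fun δ hδ =>
    (hident _ _ (bath_facts_of_abs_lt hδ₀T hϑT hδ).1 (bath_facts_of_abs_lt hδ₀T hϑT hδ).2.1).2
  have hlr := pinnedChain_linear_response_of_uniformMixing hω hl.le hβ hγ hN hT hδ₀ hδ₀T hϑ hϑT hφ2 hφ
    hCm hc hUM (pinnedChain_tendsto_integral_kernel_temps hω hl.le hβ.le hγ hN hT hϑ h2ϑ hφ2.continuous hφ)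
    (fun δ => μ (T + δ / 2) (T - δ / 2)) hμP hμI
  rw [hrepr φ C hφ2 hφ] at hlr
  simp only [zero_div, add_zero, sub_zero] at hlr
  rw [hTT] at hlr
  exact hlr

/-! ## C. A response density agrees with the weighted density on `C_c^∞`, hence on tempered observables -/

/-- The `C_c^∞` expansion of `IsResponseDensityAt` along a steady family, as a one-sided limit. -/
theorem IsResponseDensityAt.tendsto_slope {T : ℝ} (hT : 0 < T) {h : PhaseSpace N → ℝ}
    (hh : IsResponseDensityAt ω₂ lam β γ T N h) (μ : ℝ → ℝ → Measure (PhaseSpace N))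
    (hμ : ∀ T_L T_R : ℝ, 0 < T_L → 0 < T_R → (pinnedChain ω₂ lam β γ).IsSteadyState N T_L T_R (μ T_L T_R))
    {F : PhaseSpace N → ℝ} (hF : ContDiff ℝ ((⊤ : ℕ∞) : WithTop ℕ∞) F) (hFc : HasCompactSupport F) :
    Tendsto (fun δ : ℝ => ((∫ x, F x ∂(μ (T + δ / 2) (T - δ / 2))) -
        ∫ x, F x ∂((pinnedChain ω₂ lam β γ).gibbsMeasure N T)) / δ)
      (𝓝[>] 0) (𝓝 (∫ x, F x * h x ∂((pinnedChain ω₂ lam β γ).gibbsMeasure N T))) := by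
  refine tendsto_slope_of_expansion fun ε hε => ?_
  obtain ⟨δ₀, hδ₀, hb⟩ := hh.2 F hF hFc ε hε
  refine ⟨min δ₀ T, lt_min hδ₀ hT, fun δ hδ hδlt => ?_⟩
  have hδ1 : δ < δ₀ := lt_of_lt_of_le hδlt (min_le_left _ _)
  have hδT : δ < T := lt_of_lt_of_le hδlt (min_le_right _ _)
  exact hb δ hδ hδ1 _ (hμ _ _ (by linarith) (by linarith))

/-- **On `C_c^∞` a response density agrees with the weighted density** (`0 ≤ ϑ`; along a steady family
both represent the same one-sided derivative). -/
theorem IsResponseDensityAt.integral_testFunction_eq (hω : 0 < ω₂) (hl : 0 ≤ lam) (hβ : 0 ≤ β)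
    {T : ℝ} (hT : 0 < T) {h hw : PhaseSpace N → ℝ} (hh : IsResponseDensityAt ω₂ lam β γ T N h)
    {ϑ : ℝ} (hϑ : 0 ≤ ϑ) (μ : ℝ → ℝ → Measure (PhaseSpace N))
    (hμ : ∀ T_L T_R : ℝ, 0 < T_L → 0 < T_R → (pinnedChain ω₂ lam β γ).IsSteadyState N T_L T_R (μ T_L T_R))
    (hW : ∀ (φ : PhaseSpace N → ℝ) (C : ℝ), ContDiff ℝ 2 φ →
      (∀ y, |φ y| ≤ C * Real.exp (ϑ * (pinnedChain ω₂ lam β γ).hamiltonian N y)) →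
      Tendsto (fun δ : ℝ => ((∫ x, φ x ∂(μ (T + δ / 2) (T - δ / 2))) -
          ∫ x, φ x ∂((pinnedChain ω₂ lam β γ).gibbsMeasure N T)) / δ)
        (𝓝[≠] 0) (𝓝 (∫ x, φ x * hw x ∂((pinnedChain ω₂ lam β γ).gibbsMeasure N T))))
    {F : PhaseSpace N → ℝ} (hF : ContDiff ℝ ((⊤ : ℕ∞) : WithTop ℕ∞) F) (hFc : HasCompactSupport F) :
    ∫ x, F x * h x ∂((pinnedChain ω₂ lam β γ).gibbsMeasure N T) =
      ∫ x, F x * hw x ∂((pinnedChain ω₂ lam β γ).gibbsMeasure N T) := by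
  obtain ⟨hF2, C, hC⟩ := testFunction_bound hω hl hβ γ hϑ hF hFc (N := N)
  have hsub : Set.Ioi (0 : ℝ) ⊆ ({0}ᶜ : Set ℝ) := fun x hx => Set.mem_compl_singleton_iff.2 (ne_of_gt hx)
  exact tendsto_nhds_unique (hh.tendsto_slope hT μ hμ hF hFc)
    ((hW F C hF2 hC).mono_left (nhdsWithin_mono 0 hsub))

/-- **Cutoff transfer.** If `∫ F h₁ dμ_T = ∫ F h₂ dμ_T` for all `F ∈ C_c^∞`, then `∫ φ h₁ dμ_T = ∫ φ h₂ dμ_T`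
for every smooth `φ` with `φ h₁, φ h₂ ∈ L¹(μ_T)` (test with `χ(H/R)·φ ∈ C_c^∞` and let `R → ∞`). -/
theorem integral_mul_eq_of_testFunctions (hω : 0 < ω₂) (hl : 0 ≤ lam) (hβ : 0 ≤ β) {T : ℝ}
    {h₁ h₂ φ : PhaseSpace N → ℝ}
    (heq : ∀ F : PhaseSpace N → ℝ, ContDiff ℝ ((⊤ : ℕ∞) : WithTop ℕ∞) F → HasCompactSupport F →
      ∫ x, F x * h₁ x ∂((pinnedChain ω₂ lam β γ).gibbsMeasure N T) =
        ∫ x, F x * h₂ x ∂((pinnedChain ω₂ lam β γ).gibbsMeasure N T))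
    (hφ : ContDiff ℝ ((⊤ : ℕ∞) : WithTop ℕ∞) φ)
    (h₁i : Integrable (fun x => φ x * h₁ x) ((pinnedChain ω₂ lam β γ).gibbsMeasure N T))
    (h₂i : Integrable (fun x => φ x * h₂ x) ((pinnedChain ω₂ lam β γ).gibbsMeasure N T)) :
    ∫ x, φ x * h₁ x ∂((pinnedChain ω₂ lam β γ).gibbsMeasure N T) =
      ∫ x, φ x * h₂ x ∂((pinnedChain ω₂ lam β γ).gibbsMeasure N T) := by
  have hR : ∀ R : ℝ, 0 < R →
      ∫ x, smoothCutoff ((pinnedChain ω₂ lam β γ).hamiltonian N x / R) * (φ x * h₁ x)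
          ∂((pinnedChain ω₂ lam β γ).gibbsMeasure N T) =
        ∫ x, smoothCutoff ((pinnedChain ω₂ lam β γ).hamiltonian N x / R) * (φ x * h₂ x)
          ∂((pinnedChain ω₂ lam β γ).gibbsMeasure N T) := by
    intro R hR
    have h := heq _ ((pinnedChain_contDiff_cutoff N γ R).mul hφ)
      ((pinnedChain_hasCompactSupport_cutoff hω hl hβ N γ hR).mul_right)
    simpa only [mul_assoc] using h
  refine tendsto_nhds_unique ((tendsto_integral_cutoff_mul h₁i).congr' ?_)
    (tendsto_integral_cutoff_mul h₂i)
  filter_upwards [eventually_gt_atTop (0 : ℝ)] with R hR0 using hR R hR0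

/-! ## D. [LINK]: the moment coefficients and the mass of a response density -/

/-- **[LINK-τ] The moment coefficient is the `p_i²`-moment of the response density:**
`IsResponseDensityAt … h → IsMomentCoefficientAt … i τ → τ = ∫ p_i² h dμ_T` (all parameters `> 0`,
`T > 0`, any site `i`).  Proof: along the canonical steady family, `δ⁻¹(⟨p_i²⟩_{μ_δ} - T) → τ`
(definition) and `→ ∫ p_i² h̃ dμ_T` ((WR), `⟨p_i²⟩_{μ_T} = T`); and `∫ p_i² h̃ = ∫ p_i² h` by §C. -/
theorem IsMomentCoefficientAt.eq_integral_sq_mul (hω : 0 < ω₂) (hl : 0 < lam) (hβ : 0 < β)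
    (hγ : 0 < γ) {T : ℝ} (hT : 0 < T) {i : Fin N} {h : PhaseSpace N → ℝ} {τ : ℝ}
    (hh : IsResponseDensityAt ω₂ lam β γ T N h) (hτ : IsMomentCoefficientAt ω₂ lam β γ T N i τ) :
    τ = ∫ x, x.2 i ^ 2 * h x ∂((pinnedChain ω₂ lam β γ).gibbsMeasure N T) := by
  have hN : 0 < N := Fin.pos i
  obtain ⟨μ, hμ, -⟩ := exists_canonical_response hω hl hβ hγ hT
  obtain ⟨ϑ, hϑ, hw, hw2, hW⟩ := exists_weightedResponseDensity hω hl hβ hγ hT hN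
  -- the observable `p_i²`
  have hpc : Continuous fun x : PhaseSpace N => x.2 i ^ 2 := by fun_prop
  have hp2 : ContDiff ℝ 2 fun x : PhaseSpace N => x.2 i ^ 2 := by fun_prop
  have hpS : ContDiff ℝ ((⊤ : ℕ∞) : WithTop ℕ∞) fun x : PhaseSpace N => x.2 i ^ 2 := by fun_prop
  have hpt : IsTempered ω₂ lam β γ N fun x : PhaseSpace N => x.2 i ^ 2 :=
    (IsTempered.snd hω.le hl.le hβ.le i).pow 2
  obtain ⟨C, hC⟩ := hpt.abs_le_exp hω.le hl.le hβ.le hϑ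
  -- `⟨p_i²⟩_{μ_T} = T`
  have hZ : 0 < ∫ x, (pinnedChain ω₂ lam β γ).gibbsDensity N T x :=
    integral_exp_pos (pinnedChain_integrable_gibbsDensity hω hl.le hβ.le γ N hT)
  have hpT : ∫ x, x.2 i ^ 2 ∂((pinnedChain ω₂ lam β γ).gibbsMeasure N T) = T := by
    have h1 := integral_snd_sq_mul_gibbsDensity_eq hω hl.le hβ.le γ hT i (F := fun _ => (1 : ℝ))
      continuous_const (IsTempered.const 1) (fun _ _ => rfl)
    simp only [mul_one, one_mul] at h1
    rw [(pinnedChain ω₂ lam β γ).integral_gibbsMeasure, h1]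
    field_simp
  -- step 1: `τ = ∫ p_i² h̃ dμ_T`
  have hsub : Set.Ioi (0 : ℝ) ⊆ ({0}ᶜ : Set ℝ) := fun x hx => Set.mem_compl_singleton_iff.2 (ne_of_gt hx)
  have h1 : Tendsto (fun δ : ℝ => ((∫ x, x.2 i ^ 2 ∂(μ N (T + δ / 2) (T - δ / 2))) - T) / δ)
      (𝓝[>] 0) (𝓝 τ) := by
    refine tendsto_slope_of_expansion fun ε hε => ?_
    obtain ⟨δ₀, hδ₀, hb⟩ := hτ ε hε
    refine ⟨min δ₀ T, lt_min hδ₀ hT, fun δ hδ hδlt => ?_⟩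
    have hδ1 : δ < δ₀ := lt_of_lt_of_le hδlt (min_le_left _ _)
    have hδT : δ < T := lt_of_lt_of_le hδlt (min_le_right _ _)
    exact hb δ hδ hδ1 _ (hμ N _ _ (by linarith) (by linarith))
  have h2 := (hW _ C hp2 hC (μ N) (hμ N)).mono_left (nhdsWithin_mono 0 hsub)
  rw [hpT] at h2
  have hτw : τ = ∫ x, x.2 i ^ 2 * hw x ∂((pinnedChain ω₂ lam β γ).gibbsMeasure N T) :=
    tendsto_nhds_unique h1 h2
  -- step 2: `∫ p_i² h̃ = ∫ p_i² h`
  rw [hτw]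
  symm
  exact integral_mul_eq_of_testFunctions hω hl.le hβ.le
    (fun F hF hFc => hh.integral_testFunction_eq hω hl.le hβ.le hT hϑ.le (μ N) (hμ N) (hW · · · · (μ N) (hμ N)) hF hFc)
    hpS (MemLp.integrable_mul (hpt.memLp_two hpc hω hl.le hβ.le hT) hh.1)
    (MemLp.integrable_mul (hpt.memLp_two hpc hω hl.le hβ.le hT) hw2)

/-- **[LINK-1] A response density has mean zero:** `IsResponseDensityAt … h → ∫ h dμ_T = 0` (`N ≥ 1`).
Proof: steady states are probability measures, so `δ⁻¹(∫ 1 dμ_δ - ∫ 1 dμ_T) = 0 → ∫ h̃ dμ_T` ((WR) with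
`φ = 1`); and `∫ h̃ = ∫ h` by §C. -/
theorem IsResponseDensityAt.integral_eq_zero (hω : 0 < ω₂) (hl : 0 < lam) (hβ : 0 < β) (hγ : 0 < γ)
    {T : ℝ} (hT : 0 < T) (hN : 0 < N) {h : PhaseSpace N → ℝ} (hh : IsResponseDensityAt ω₂ lam β γ T N h) :
    ∫ x, h x ∂((pinnedChain ω₂ lam β γ).gibbsMeasure N T) = 0 := by
  obtain ⟨μ, hμ, -⟩ := exists_canonical_response hω hl hβ hγ hT
  obtain ⟨ϑ, hϑ, hw, hw2, hW⟩ := exists_weightedResponseDensity hω hl hβ hγ hT hN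
  haveI := pinnedChain_isProbabilityMeasure_gibbsMeasure hω hl.le hβ.le γ N hT
  -- the observable `1`
  have h1c : ContDiff ℝ 2 fun _ : PhaseSpace N => (1 : ℝ) := contDiff_const
  have h1b : ∀ y : PhaseSpace N, |(fun _ : PhaseSpace N => (1 : ℝ)) y| ≤
      1 * Real.exp (ϑ * (pinnedChain ω₂ lam β γ).hamiltonian N y) := fun y => by
    simp only [abs_one, one_mul]
    exact Real.one_le_exp (mul_nonneg hϑ.le (pinnedChain_hamiltonian_nonneg hω.le hl.le hβ.le γ N y))
  -- step 1: `∫ h̃ dμ_T = 0`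
  have hlim := hW _ 1 h1c h1b (μ N) (hμ N)
  have hzero : Tendsto (fun δ : ℝ => ((∫ _x, (1 : ℝ) ∂(μ N (T + δ / 2) (T - δ / 2))) -
      ∫ _x, (1 : ℝ) ∂((pinnedChain ω₂ lam β γ).gibbsMeasure N T)) / δ) (𝓝[≠] 0) (𝓝 0) := by
    refine tendsto_const_nhds.congr' ?_
    have hball : ∀ᶠ δ : ℝ in 𝓝 (0 : ℝ), |δ| < T := by
      have : Metric.ball (0 : ℝ) T ∈ 𝓝 (0 : ℝ) := Metric.ball_mem_nhds 0 hT
      filter_upwards [this] with δ hδ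
      simpa [Real.dist_eq] using hδ
    filter_upwards [hball.filter_mono nhdsWithin_le_nhds] with δ hδ
    obtain ⟨hδ1, hδ2⟩ := abs_lt.1 hδ
    haveI := (hμ N (T + δ / 2) (T - δ / 2) (by linarith) (by linarith)).1
    simp only [integral_const, probReal_univ, smul_eq_mul, mul_one, sub_self, zero_div]
  have hw0 : ∫ x, (1 : ℝ) * hw x ∂((pinnedChain ω₂ lam β γ).gibbsMeasure N T) = 0 :=
    tendsto_nhds_unique hlim hzero
  -- step 2: `∫ h = ∫ 1·h = ∫ 1·h̃ = 0`
  have hh1 : ∫ x, (1 : ℝ) * h x ∂((pinnedChain ω₂ lam β γ).gibbsMeasure N T) =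
      ∫ x, (1 : ℝ) * hw x ∂((pinnedChain ω₂ lam β γ).gibbsMeasure N T) :=
    integral_mul_eq_of_testFunctions hω hl.le hβ.le
      (fun F hF hFc => hh.integral_testFunction_eq hω hl.le hβ.le hT hϑ.le (μ N) (hμ N)
        (hW · · · · (μ N) (hμ N)) hF hFc)
      contDiff_const (by simpa only [one_mul] using hh.1.integrable one_le_two)
      (by simpa only [one_mul] using hw2.integrable one_le_two)
  rw [hw0] at hh1
  simpa only [one_mul] using hh1

end Summit.AtomisticToContinuum.FouriersLaw.Theorems.SubdiffusiveBondHeat.EscapeGrading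

end
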